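import Literature.MathematicalPhysics.QuantumFieldTheory.Balaban1983to89.Node00.Record12BgRowCoClassGaugeRGuardedBRowAllTorusLam
import Summits.QuantumFields.YangMills.Theorems.BalabanUVNodesN07Thm1Top7FromProp8GuardedB
import Summits.QuantumFields.YangMills.Theorems.BalabanUVNodesN26AtRecord13BetaBoxOfDriftAtSlope

/-!
# K0⁷ — THE ALL-TORUS K0 BODY AT `θ₁₅ᶜᶜᴹ(j; γ)` AND THE (j, c, c₀)-GENERIC STUB COMPOSITION OVER PRINT's [II] (2.3) DATUM — №365 SIBLING `…K0AllTorusOfStepTokensGuardedB` of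
# `…K0AllTorusOfStepTokensGuarded`: the GUARDED (8)-SENTENCE `VariationalThm1RegSepCoP7MGB F N Adm (lamDatum F) Dat B₃ a₀ a₁`, concrete two-letter guard `Adm := fun ν _ _ K k _ => c ≤ ν.M₁ ∧ k + c₀ ≤ F.m + K`

Cell `pub-ymgap`, seat `pub-ymgap-k0-s1-w2` generation 7 (K0⁷ `stmt-QuantumFields-20541` helper lane; `--kind proof --supports stmt-QuantumFields-20541 --as helper`; count-neutral).
NEW additive module, theorems only (0 `def`, 0 `sorry`); nothing in the tree is modified.  Parent text: `…K0AllTorusOfStepTokensGuarded` (seat `pub-ymgap-k0-s1-w3` g7, V20 option G).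

WHY A SIBLING (director-ym №365, 2026-08-30; gate8 R558: «the supported path for CLASS-T hypothesis re-typing is RENAME-AND-REDIRECT»; (E1) variant (iii-b) of record, №338 ∕ №339 (α) ∕ №343 (D1);
FLAG №16 ∕ LOCATE-HSEAM 5d3298b8d191f169).  After node00-def-R's seam edit of `Node00/Record13CoP`, `UbgOfRecord₁₃CoP … (n+1)` IS `UbgMSCoPOfRecordB …` (print's class read on the [II]
(2.3) bond datum `lamBondsSeq`; `UbgOfRecord₁₃CoP_succ`, `rfl`), so the parent's ONE seam reader (§2's `rw [UbgOfRecord₁₃CoP_succ]`) needs row P11 at THAT background and its displayed [15]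
sentences must be read over `(lamDatum F, Dat)`; `Summits/…/Theorems/` statements are immutable (`theorems.append-only`), hence THIS sibling: the parent's §2–§5 under the SAME short names
in the NEW namespace `…K0AllTorusOfStepTokensGuardedB`, every [15] token ↦ the `(bd, Dat)` ᴮ token AT `bd := lamDatum F` — `VariationalThm1RegSepCoP7MG` ↦ `…MGB` (S1a-C
`Node00/Record12BgRowCoClassCPMFloorB`), `VariationalThm1GaugeRegSepCoP7MG` ↦ `…MGB` (S1b-2), `Gauge9RegSepTopStepG` ↦ `…GB` (S1b-1), `Prop8RegSepTopStepG` ↦ `…GB` (F0c), §5's R texts ↦ the ᴮ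
tokens at `floorGuard F c`; the data predicate is a PARAMETER `Dat : TopData F N` (`DatF F` under `∀ F`) and every θ-level theorem DISPLAYS the (7) transfer `hDat` (k0-s1-w1's `…GuardedZBLam`
convention: `id`-shaped at `dataSmall7PTopOf F N`; `K0AllTorusOfStepTokensGuardedZBLam.hDat_dataSmall7LamTopOf` at print's `dataSmall7LamTopOf F N` — both kernel-checked against §2);
conclusions byte-identical to the parent's.  THE SEAM ITSELF IS DISPLAYED (k0-s1-w1's `…GuardedZBLam` shape, so that this module is GREEN ON BOTH SIDES of the seam edit and files
as an ordinary NEW leaf): every seam-dependent theorem carries the hypothesis `hseam : ∀ θ p n s W, UbgOfRecord₁₃CoP F N θ p (n+1) s W = UbgMSCoPOfRecordB F N θ.ν θ.τ9.M (gOfRecord₁₃ F N θ p) p.K (n+1) s W`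
right after `hDat` — BEFORE the seam edit NOT provable (the (b) background is not the `Λ`-minimiser) and NOT claimed; AFTER it: `fun θ p n s W => by rw [UbgOfRecord₁₃CoP_succ]` (one line,
or k0-s1-w1's `K0AllTorusOfStepTokensGuardedZBLam.hseam_holds F N` once his post-seam leaf lands).  NOT carried (№365: no copies of landed statements): the parent's datum-free §0
`succ_add_le_of_partCompat₁₃` (its five lines are inlined in
§2) and §1 (≡ k0-s1-w1's leaf `Node00/…GaugeRGuardedBRowAllTorusLam.Stage13Params.bgAtDatumCoPB_of_thm1RegSepCoP7MGB_of_thm1GaugeGB_allTorus` ✓p767852, cited by name); PART 1 §1's token-free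
`clausesH_of_absBox` is inlined (its module is residue).  The parent module is NOT touched (residue after the seam: red — unbuildable, NOT false; R556 attic later).

WHY.  The lane owner's `V20-STUB1-TEXT-PROPOSAL.md` (dag-n07-e, 2026-08-28) offers the plan two re-texts of stub 1; option G guards [15] Prop. 8's top step by the floor
`c ≤ ν.M₁` AND the head's level letter `k + c₀ ≤ F.m + K` (LOCATED-UNGUARDED-LEVELS: the S6 knit's datum windows wrap at the top `c₀` levels of a short torus):
stub 1-G `∃ (c c₀ : ℕ) (B₃ a₀ a₁ : ℝ), 2L² ≤ B₃ ∧ 0 < a₀ ∧ 0 < a₁ ∧ Prop8RegSepTopStepG F 2 suppDom (fun ν _M _g K k _s => c ≤ ν.M₁ ∧ k + c₀ ≤ F.m + K) B₃ a₀ a₁` (module 47).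
The K0 BODY applies the (8)∕(9)-sentences only at runs `(p, n)` with `PartCompat₁₃ θ p n`, where `n + a + 1 ≤ F.m + p.K` for the cube exponent `a` (dag-n21-c's arithmetic behind
`hsN_of_partCompat₁₃`; the parent's §0, inlined in §2 here) — so the level letter is DISCHARGED by the body once it picks `a = j ≥ c₀ − 1`, exactly as the floor is discharged by `c ≤ L^j = ν.M₁(θ)`.
THIS FILE is the all-torus closer chain (p575996 §2–§4) and PART 1 §2–§4 (p589753) in G-currency over the ᴮ rows (`Node00/…GaugeRGuardedBRowAllTorusLam`: the Stage-13 lift for ANY guard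
met at the torus-compatible runs (outer hypothesis `hAdm`) and any `Dat`; `…GaugeRGuardedB`: `variationalThm1GaugeRegSepCoP7MGB_of_gauge9TopStepGB`) and the (8)-ᴮ bridge
(`…N07Thm1Top7FromProp8GuardedB`: `variationalThm1RegSepCoP7MGB_of_prop8TopStepGB_lamDatum`): §2–§3 the witness and the closers at the CONCRETE guard (`hAdm` from `c ≤ L^j`, `c₀ ≤ j + 1`
and the level letter), §4 PART 1-G, §5 the directions R ⇒ G (stub 1) and G ⇒ R (3ᴬ′) (section numbers kept from the parent).

HONEST FRAMING: count-neutral kernel re-keying BY NAME; CONDITIONAL on `hseam` (the Stage-2 seam — NOT in the tree at filing time) and `hDat`; every [15]∕[6]∕[I] sentence is a HYPOTHESIS (a `Prop`, never asserted, inhabited nowhere here); the compositions are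
CONDITIONAL on the stub texts; the plan words and registers V20 (R or G) — nothing here is a registration or a vote; `stub_prop8StepCoP13` ∕ K0⁷ ∕ K1⁹ NOT closed; N07 NOT
discharged; counts unmoved (typed 28∕28 · discharged 8∕28); the route closes only the conditional finite-𝕋⁴ rung `BalabanLadder.UV` — the YM mass gap (Clay) is NOT proved by any
of this; nothing continuum ∕ ℝ⁴ ∕ OS; a sibling re-text is NOT progress by itself.  No `sorry`, `def`, `instance`, `notation`.
[15] = Bałaban, CMP 102 (1985) 277–309 [Balaban1985Variational]; [6] = CMP 99 (1985) 75 [Balaban1985RegularSpaces]; [III] = CMP 119 (1988) 243 [Balaban1988Convergent];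
[I] = CMP 109 (1987) 249 [Balaban1987RG1]; [II] = CMP 96 (1984) 223 [Balaban1984PropagatorsII] ((2.3) p.224: the `Λ`-datum); [LFII] = CMP 122 (1989) 355 [Balaban1989LargeFieldII];
[RG2] = CMP 116 (1988) 1 [Balaban1988RG2Cluster].
-/

noncomputable section

open MeasureTheory
open scoped Matrix.Norms.L2Operator

namespace Summit.QuantumFields.YangMills.Theorems.K0AllTorusOfStepTokensGuardedB

open Literature.MathematicalPhysics.QuantumFieldTheory.Balaban1983to89
open Literature.MathematicalPhysics.QuantumFieldTheory.Balaban1983to89.Node00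
open Literature.MathematicalPhysics.QuantumFieldTheory.Balaban1983to89.T4Continuum
open Literature.MathematicalPhysics.QuantumFieldTheory.Balaban1983to89.FlowStep
open Literature.MathematicalPhysics.QuantumFieldTheory.Balaban1983to89.FlowStepRuns
open Literature.MathematicalPhysics.QuantumFieldTheory.Balaban1983to89.B14.Eq218Concrete
open Literature.MathematicalPhysics.QuantumFieldTheory.Balaban1983to89.B15DeterminingSets
open Literature.MathematicalPhysics.QuantumFieldTheory.Balaban1983to89.B12RegularSpaces111
open Literature.MathematicalPhysics.QuantumFieldTheory.Balaban1983to89.B14RegularSpaces234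
open Literature.MathematicalPhysics.QuantumFieldTheory.Balaban1983to89.Beta.Drift (OneLoopDrift)
open Summit.QuantumFields.BalabanUV.Gaps.BetaContFromD4Chain (AtSlopeCont)
open Literature.MathematicalPhysics.QuantumFieldTheory.Balaban1983to89.B15DeterminingSetsB
open Summit.QuantumFields.YangMills.BalabanUVNodes.N07Thm1Top7FromProp8GuardedB (variationalThm1RegSepCoP7MGB_of_prop8TopStepGB_lamDatum)
open Summit.QuantumFields.YangMills.Theorems.BalabanUVNodesN26AtRecord13BetaBoxOfDriftAtSlope (exists_betaBox_betaOfRecord₁₃_of_jetsFreePair)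

/-! ## §2  ★★ At `θ₁₅ᶜᶜᴹ(j; γ)` with the CONCRETE two-letter guard: the (7)-guarded separated row P11 at the Co carrier, on EVERY family -/

section AtWitnessGuarded

variable {F : T4Family} {N : ℕ} [NeZero N] {Dat : TopData F N} {j c c₀ : ℕ} {γ ε₀ ε₂₉ B₃ B₃' a₀ a₁ : ℝ}

/-- **★★ THE (7)-GUARDED SEPARATED ROW P11 AT THE Co CARRIER AT `θ₁₅ᶜᶜᴹ(j; γ)` FROM `0 < γ ≤ ½`, THE GUARDED (8) AND THE GUARDED GAUGE SENTENCE OVER `(lamDatum F, Dat)` AT `(L^j, Adm)`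
FOR THE CONCRETE GUARD `Adm := fun ν _ _ K k _ => c ≤ ν.M₁ ∧ k + c₀ ≤ F.m + K` WITH `c ≤ L^j` AND `c₀ ≤ j + 1`, THE (7) DATA TRANSFER `hDat` (the support's `Sect2.DataSmall7PTop` ⟹ `Dat`
at torus-compatible prefixes: `id`-shaped at `Dat := dataSmall7PTopOf F N`; P0's `dataSmall7LamTopOf_of_seq` ∘ `blockSat_seqOfRecord` at print's `dataSmall7LamTopOf F N`), AND (hcomp) ∧ (hcompRev),
ON EVERY FAMILY** — k0-s1-w1's whole-torus row `Stage13Params.bgAtDatumCoPB_of_thm1RegSepCoP7MGB_of_thm1GaugeGB_allTorus` (`Node00/…GaugeRGuardedBRowAllTorusLam`) at the witness, `hAdm` DISCHARGED at every torus-compatible run — the floor by `ν.M₁(θ₁₅ᶜᶜᴹ(j; γ)) = L^j ≥ c` (A2ʷ `theta13OfThm1CCMW_M₁`), the level letter (the parent's §0, inlined: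
`n + j + 1 ≤ F.m + p.K`, `τ9.M = L^j`) and `c₀ ≤ j + 1`.  STAGE-2 RE-KEY (director-ym №343 (D1)∕(D5), (E1) variant (iii-b); seat k0-s1-w2 g7): the row is stated about
`UbgOfRecord₁₃CoP` BY NAME, which at level `n + 1` IS node00-def-R's print-datum background `UbgMSCoPOfRecordB …` (`UbgOfRecord₁₃CoP_succ`, [II] (2.3) `Λ`-fibre) — hence the two [15]
sentences are read over `(lamDatum F, Dat)`; the conclusion's bytes are unchanged.  CONDITIONAL; nothing of Bałaban asserted.
[cite: Balaban1985Variational, (6)–(7) p.278, Thm 1 (8)–(9) p.279, (144)–(152) pp.300–301, Prop. 8 p.304, p.304 lines 1–2; Balaban1985RegularSpaces, (1.3)–(1.9) p.77; Balaban1984PropagatorsII, (2.3) p.224; Balaban1988Convergent, Thm 1 p.262, (2.1) p.254, (2.4)–(2.8) pp.255–256, (2.12)–(2.13) pp.256–257, (2.18) p.257, (2.25)–(2.28) pp.258–259; Balaban1987RG1, Thm 1 p.259, (0.1) p.251, (1.12) p.262] -/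
theorem bgSepCoPAt_theta13OfThm1CCMW_of_thm1RegSepCoP7MG_of_thm1GaugeG_of_hcomp_allTorus (hγ0 : 0 < γ) (hγ : γ ≤ 1 / 2) (hε : 0 < ε₀) (hε' : 0 < ε₂₉) (hB : 0 ≤ B₃) (hB' : 0 ≤ B₃')
    (ha₀ : 0 < a₀) (ha₁ : 0 < a₁) (hc : c ≤ F.L ^ j) (hc₀ : c₀ ≤ j + 1)
    (h15 : VariationalThm1RegSepCoP7MGB F N (fun ν _M _g K k _s => c ≤ ν.M₁ ∧ k + c₀ ≤ F.m + K) (lamDatum F) Dat B₃ a₀ a₁)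
    (h15G : VariationalThm1GaugeRegSepCoP7MGB F N (F.L ^ j) (fun ν _M _g K k _s => c ≤ ν.M₁ ∧ k + c₀ ≤ F.m + K) (lamDatum F) Dat B₃ B₃' a₀ a₁)
    (hDat : ∀ (θ : Stage13Params F N) (p : B12.RunParams) (n : ℕ) (s : SeqOfRecord F θ.ν θ.τ9.M (gOfRecord₁₃ F N θ p) p.K n) (δ : ℕ → ℝ) (W : MSField (F.P p.K) (SU N)), n ≤ p.K → PartCompat₁₃ F N θ p n →
      Sect2.DataSmall7PTop (avOfRecord F N p.K) s.Ω (suppDomOfRecord F θ.ν p.K s.Ω) n δ W → Dat p.K s.Ω (suppDomOfRecord F θ.ν p.K s.Ω) n δ W)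
    (hseam : ∀ (θ : Stage13Params F N) (p : B12.RunParams) (n : ℕ) (s : SeqOfRecord F θ.ν θ.τ9.M (gOfRecord₁₃ F N θ p) p.K (n + 1)) (W : MSField (F.P p.K) (SU N)),
      UbgOfRecord₁₃CoP F N θ p (n + 1) s W = UbgMSCoPOfRecordB F N θ.ν θ.τ9.M (gOfRecord₁₃ F N θ p) p.K (n + 1) s W)
    (hcomp : ∀ (p : B12.RunParams) (n : ℕ), n ≤ p.K → Step.InInterval (theta13OfThm1CCMW F N j γ ε₀ ε₂₉ B₃ B₃' a₀ a₁).γ n (gOfRecord₁₃ F N (theta13OfThm1CCMW F N j γ ε₀ ε₂₉ B₃ B₃' a₀ a₁) p) → ∀ m, m < n →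
      (theta13OfThm1CCMW F N j γ ε₀ ε₂₉ B₃ B₃' a₀ a₁).s2.cR * epsOfRecord (theta13OfThm1CCMW F N j γ ε₀ ε₂₉ B₃ B₃' a₀ a₁).ν (gOfRecord₁₃ F N (theta13OfThm1CCMW F N j γ ε₀ ε₂₉ B₃ B₃' a₀ a₁) p) m ≤ 2 * ((theta13OfThm1CCMW F N j γ ε₀ ε₂₉ B₃ B₃' a₀ a₁).s2.cR * epsOfRecord (theta13OfThm1CCMW F N j γ ε₀ ε₂₉ B₃ B₃' a₀ a₁).ν (gOfRecord₁₃ F N (theta13OfThm1CCMW F N j γ ε₀ ε₂₉ B₃ B₃' a₀ a₁) p) (m + 1)))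
    (hcompRev : ∀ (p : B12.RunParams) (n : ℕ), n ≤ p.K → Step.InInterval (theta13OfThm1CCMW F N j γ ε₀ ε₂₉ B₃ B₃' a₀ a₁).γ n (gOfRecord₁₃ F N (theta13OfThm1CCMW F N j γ ε₀ ε₂₉ B₃ B₃' a₀ a₁) p) → ∀ m, m < n →
      (theta13OfThm1CCMW F N j γ ε₀ ε₂₉ B₃ B₃' a₀ a₁).s2.cR * epsOfRecord (theta13OfThm1CCMW F N j γ ε₀ ε₂₉ B₃ B₃' a₀ a₁).ν (gOfRecord₁₃ F N (theta13OfThm1CCMW F N j γ ε₀ ε₂₉ B₃ B₃' a₀ a₁) p) (m + 1) ≤ 2 * ((theta13OfThm1CCMW F N j γ ε₀ ε₂₉ B₃ B₃' a₀ a₁).s2.cR * epsOfRecord (theta13OfThm1CCMW F N j γ ε₀ ε₂₉ B₃ B₃' a₀ a₁).ν (gOfRecord₁₃ F N (theta13OfThm1CCMW F N j γ ε₀ ε₂₉ B₃ B₃' a₀ a₁) p) m)) :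
    ∀ (p : B12.RunParams) (n : ℕ), n ≤ p.K → Step.InInterval (theta13OfThm1CCMW F N j γ ε₀ ε₂₉ B₃ B₃' a₀ a₁).γ n (gOfRecord₁₃ F N (theta13OfThm1CCMW F N j γ ε₀ ε₂₉ B₃ B₃' a₀ a₁) p) → PartCompat₁₃ F N (theta13OfThm1CCMW F N j γ ε₀ ε₂₉ B₃ B₃' a₀ a₁) p n →
      ∀ s : SeqOfRecord F (theta13OfThm1CCMW F N j γ ε₀ ε₂₉ B₃ B₃' a₀ a₁).ν (theta13OfThm1CCMW F N j γ ε₀ ε₂₉ B₃ B₃' a₀ a₁).τ9.M (gOfRecord₁₃ F N (theta13OfThm1CCMW F N j γ ε₀ ε₂₉ B₃ B₃' a₀ a₁) p) p.K n, Sect2.SeqSeparated (theta13OfThm1CCMW F N j γ ε₀ ε₂₉ B₃ B₃' a₀ a₁).ν.M₁ s →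
      ∀ W : MSField (F.P p.K) (SU N), W ∈ suppOfRecord₁₃P F N (theta13OfThm1CCMW F N j γ ε₀ ε₂₉ B₃ B₃' a₀ a₁) p n s →
      Sect2.DataSmall7PTop (avOfRecord F N p.K) s.Ω (suppDomOfRecord F (theta13OfThm1CCMW F N j γ ε₀ ε₂₉ B₃ B₃' a₀ a₁).ν p.K s.Ω) n (fun j' => (theta13OfThm1CCMW F N j γ ε₀ ε₂₉ B₃ B₃' a₀ a₁).s2.cR * epsOfRecord (theta13OfThm1CCMW F N j γ ε₀ ε₂₉ B₃ B₃' a₀ a₁).ν (gOfRecord₁₃ F N (theta13OfThm1CCMW F N j γ ε₀ ε₂₉ B₃ B₃' a₀ a₁) p) j') W →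
      ∀ j', 1 ≤ j' → j' ≤ n → ∀ X : (Sect2.domSys (F.P p.K) (theta13OfThm1CCMW F N j γ ε₀ ε₂₉ B₃ B₃' a₀ a₁).τ9.M j').Dom,
      (Sect2.domSites (F.P p.K) (theta13OfThm1CCMW F N j γ ε₀ ε₂₉ B₃ B₃' a₀ a₁).τ9.M j' X ⊆ s.Λ j' →
        Sect2.ofBackgroundC (settingOfRecord₁₃ F N (theta13OfThm1CCMW F N j γ ε₀ ε₂₉ B₃ B₃' a₀ a₁) p).ι (UbgOfRecord₁₃CoP F N (theta13OfThm1CCMW F N j γ ε₀ ε₂₉ B₃ B₃' a₀ a₁) p n s W) ∈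
          Sect2.spaceI (settingOfRecord₁₃ F N (theta13OfThm1CCMW F N j γ ε₀ ε₂₉ B₃ B₃' a₀ a₁) p) ((theta13OfThm1CCMW F N j γ ε₀ ε₂₉ B₃ B₃' a₀ a₁).Rz p.K) (theta13OfThm1CCMW F N j γ ε₀ ε₂₉ B₃ B₃' a₀ a₁).τ9.M j' (Sect2.domSites (F.P p.K) (theta13OfThm1CCMW F N j γ ε₀ ε₂₉ B₃ B₃' a₀ a₁).τ9.M j' X)
            ((settingOfRecord₁₃ F N (theta13OfThm1CCMW F N j γ ε₀ ε₂₉ B₃ B₃' a₀ a₁) p).lf.alpha0 ((settingOfRecord₁₃ F N (theta13OfThm1CCMW F N j γ ε₀ ε₂₉ B₃ B₃' a₀ a₁) p).flow.g j')) ((settingOfRecord₁₃ F N (theta13OfThm1CCMW F N j γ ε₀ ε₂₉ B₃ B₃' a₀ a₁) p).lf.alpha1 ((settingOfRecord₁₃ F N (theta13OfThm1CCMW F N j γ ε₀ ε₂₉ B₃ B₃' a₀ a₁) p).flow.g j'))) ∧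
      (Sect2.admB (F.P p.K) (theta13OfThm1CCMW F N j γ ε₀ ε₂₉ B₃ B₃' a₀ a₁).ν (theta13OfThm1CCMW F N j γ ε₀ ε₂₉ B₃ B₃' a₀ a₁).τ9.M (gOfRecord₁₃ F N (theta13OfThm1CCMW F N j γ ε₀ ε₂₉ B₃ B₃' a₀ a₁) p) s.Ω s.Λ j' (Sect2.domSites (F.P p.K) (theta13OfThm1CCMW F N j γ ε₀ ε₂₉ B₃ B₃' a₀ a₁).τ9.M j' X) = true →
        Sect2.ofBackgroundC (settingOfRecord₁₃ F N (theta13OfThm1CCMW F N j γ ε₀ ε₂₉ B₃ B₃' a₀ a₁) p).ι (UbgOfRecord₁₃CoP F N (theta13OfThm1CCMW F N j γ ε₀ ε₂₉ B₃ B₃' a₀ a₁) p n s W) ∈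
          Sect2.spaceMS (settingOfRecord₁₃ F N (theta13OfThm1CCMW F N j γ ε₀ ε₂₉ B₃ B₃' a₀ a₁) p) ((theta13OfThm1CCMW F N j γ ε₀ ε₂₉ B₃ B₃' a₀ a₁).Rz p.K) (theta13OfThm1CCMW F N j γ ε₀ ε₂₉ B₃ B₃' a₀ a₁).τ9.M j' (Sect2.domSites (F.P p.K) (theta13OfThm1CCMW F N j γ ε₀ ε₂₉ B₃ B₃' a₀ a₁).τ9.M j' X) s.Ω) := by
  intro p n hn hw hpc s hsep W _ h7
  cases n with
  | zero => intro j' h1 hj'; exfalso; omega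
  | succ n =>
    rw [hseam]
    refine Stage13Params.bgAtDatumCoPB_of_thm1RegSepCoP7MGB_of_thm1GaugeGB_allTorus (theta13OfThm1CCMW F N j γ ε₀ ε₂₉ B₃ B₃' a₀ a₁)
      (admissible_theta13OfThm1CCMW_of_le_half F N hγ0 hγ hε hε' hB hB' ha₀ ha₁) rfl
      (τ9_M_pos_theta13OfThm1CCMW F N j γ ε₀ ε₂₉ B₃ B₃' a₀ a₁) h15 h15G (hnum_theta13OfThm1CCMW hγ hB hB' ha₀ ha₁) εreg_le_theta13OfThm1CCMW
      hcomp hcompRev (hBα_theta13OfThm1CCMW hγ hB hB' ha₀.le ha₁.le)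
      (htI_theta13OfThm1CCMW hγ hB hB' ha₀.le ha₁.le) (htMS_theta13OfThm1CCMW hγ hB hB' ha₀.le ha₁.le) (hC1_theta13OfThm1CCMW hγ) ⟨j, theta13OfThm1CCMW_τ9_M F N j γ ε₀ ε₂₉ B₃ B₃' a₀ a₁⟩
      (fun p' n' s' hn1 hn' hw' hpc' => ⟨?_, ?_⟩) p (n + 1) hn hw hpc s hsep (M₁_pos_theta13OfThm1CCMW F N j γ ε₀ ε₂₉ B₃ B₃' a₀ a₁) W (hDat _ p (n + 1) s _ W hn hpc h7)
    · rw [theta13OfThm1CCMW_M₁]; exact hc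
    · -- the level letter at this torus-compatible run (the residue parent's §0 `succ_add_le_of_partCompat₁₃`, inlined — №365: no copy of a landed statement): `L^e ∣ 2·L^f ⇒ e ≤ f` for `L` odd `> 1`, from `PartCompat₁₃` ∧ (C1)
      obtain ⟨t, _, hR⟩ := (hC1_theta13OfThm1CCMW hγ) p' n' hn' hw' n' hn1 le_rfl
      have hdvd := hpc' n' hn1 le_rfl
      rw [hR, theta13OfThm1CCMW_τ9_M] at hdvd
      have hd : F.L ^ n' * F.L ^ j * (F.L * t) ∣ 2 * F.L ^ (F.m + p'.K - 0) := hdvd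
      rw [Nat.sub_zero] at hd
      have key : F.L ^ (n' + j + 1) ∣ 2 * F.L ^ (F.m + p'.K) := (Dvd.intro t (by ring) : F.L ^ (n' + j + 1) ∣ F.L ^ n' * F.L ^ j * (F.L * t)).trans hd
      have h := (Nat.pow_dvd_pow_iff_le_right F.hL.2).mp ((Nat.Coprime.pow_left (n' + j + 1) (Odd.coprime_two_right F.hL.1)).dvd_of_dvd_mul_left key)
      omega

end AtWitnessGuarded

/-! ## §3  Closers keyed on the GUARDED (8) at the concrete guard, (hcomp) ∧ (hcompRev), on EVERY family -/

section ClosersGuarded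

variable {j c c₀ : ℕ} {γ ε₀ ε₂₉ B₃ B₃' a₀ a₁ : ℝ}

/-- **THE v1.5 K0 BODY (⁵) FOR `F` AT `N = 2` AT `θ₁₅ᶜᶜᴹ(j; γ)` FROM `0 < γ ≤ ½`, THE GUARDED (8)∕GAUGE SENTENCES AT THE CONCRETE GUARD (`c ≤ L^j`, `c₀ ≤ j + 1`) AND (hcomp) ∧ (hcompRev), ON
EVERY FAMILY** (16a's socket ∘ §2) — p575996 §4's `exists_k0SepCoP_thm1CCMW_of_thm1GaugeR_of_hcomp_allTorus` in G-currency.  CONDITIONAL; K0 NOT closed here.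
[cite: Balaban1985Variational, Thm 1 (8)–(9) p.279, (152) p.301, Prop. 8 p.304, p.304 lines 1–2; Balaban1988Convergent, Thm 1 p.262, (2.4)–(2.8) pp.255–256, p.257; Balaban1987RG1, Thm 1 p.259, (0.1) p.251] -/
theorem exists_k0SepCoP_thm1CCMW_of_thm1RegSepCoP7MG_of_thm1GaugeG_of_hcomp_allTorus (F : T4Family) {Dat : TopData F 2} (hγ0 : 0 < γ) (hγ : γ ≤ 1 / 2) (hε : 0 < ε₀) (hε' : 0 < ε₂₉) (hB : 0 ≤ B₃)
    (hB' : 0 ≤ B₃') (ha₀ : 0 < a₀) (ha₁ : 0 < a₁) (hc : c ≤ F.L ^ j) (hc₀ : c₀ ≤ j + 1)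
    (h15 : VariationalThm1RegSepCoP7MGB F 2 (fun ν _M _g K k _s => c ≤ ν.M₁ ∧ k + c₀ ≤ F.m + K) (lamDatum F) Dat B₃ a₀ a₁)
    (h15G : VariationalThm1GaugeRegSepCoP7MGB F 2 (F.L ^ j) (fun ν _M _g K k _s => c ≤ ν.M₁ ∧ k + c₀ ≤ F.m + K) (lamDatum F) Dat B₃ B₃' a₀ a₁)
    (hDat : ∀ (θ : Stage13Params F 2) (p : B12.RunParams) (n : ℕ) (s : SeqOfRecord F θ.ν θ.τ9.M (gOfRecord₁₃ F 2 θ p) p.K n) (δ : ℕ → ℝ) (W : MSField (F.P p.K) (SU 2)), n ≤ p.K → PartCompat₁₃ F 2 θ p n →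
      Sect2.DataSmall7PTop (avOfRecord F 2 p.K) s.Ω (suppDomOfRecord F θ.ν p.K s.Ω) n δ W → Dat p.K s.Ω (suppDomOfRecord F θ.ν p.K s.Ω) n δ W)
    (hseam : ∀ (θ : Stage13Params F 2) (p : B12.RunParams) (n : ℕ) (s : SeqOfRecord F θ.ν θ.τ9.M (gOfRecord₁₃ F 2 θ p) p.K (n + 1)) (W : MSField (F.P p.K) (SU 2)),
      UbgOfRecord₁₃CoP F 2 θ p (n + 1) s W = UbgMSCoPOfRecordB F 2 θ.ν θ.τ9.M (gOfRecord₁₃ F 2 θ p) p.K (n + 1) s W)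
    (hcomp : ∀ (p : B12.RunParams) (n : ℕ), n ≤ p.K → Step.InInterval (theta13OfThm1CCMW F 2 j γ ε₀ ε₂₉ B₃ B₃' a₀ a₁).γ n (gOfRecord₁₃ F 2 (theta13OfThm1CCMW F 2 j γ ε₀ ε₂₉ B₃ B₃' a₀ a₁) p) → ∀ m, m < n →
      (theta13OfThm1CCMW F 2 j γ ε₀ ε₂₉ B₃ B₃' a₀ a₁).s2.cR * epsOfRecord (theta13OfThm1CCMW F 2 j γ ε₀ ε₂₉ B₃ B₃' a₀ a₁).ν (gOfRecord₁₃ F 2 (theta13OfThm1CCMW F 2 j γ ε₀ ε₂₉ B₃ B₃' a₀ a₁) p) m ≤ 2 * ((theta13OfThm1CCMW F 2 j γ ε₀ ε₂₉ B₃ B₃' a₀ a₁).s2.cR * epsOfRecord (theta13OfThm1CCMW F 2 j γ ε₀ ε₂₉ B₃ B₃' a₀ a₁).ν (gOfRecord₁₃ F 2 (theta13OfThm1CCMW F 2 j γ ε₀ ε₂₉ B₃ B₃' a₀ a₁) p) (m + 1)))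
    (hcompRev : ∀ (p : B12.RunParams) (n : ℕ), n ≤ p.K → Step.InInterval (theta13OfThm1CCMW F 2 j γ ε₀ ε₂₉ B₃ B₃' a₀ a₁).γ n (gOfRecord₁₃ F 2 (theta13OfThm1CCMW F 2 j γ ε₀ ε₂₉ B₃ B₃' a₀ a₁) p) → ∀ m, m < n →
      (theta13OfThm1CCMW F 2 j γ ε₀ ε₂₉ B₃ B₃' a₀ a₁).s2.cR * epsOfRecord (theta13OfThm1CCMW F 2 j γ ε₀ ε₂₉ B₃ B₃' a₀ a₁).ν (gOfRecord₁₃ F 2 (theta13OfThm1CCMW F 2 j γ ε₀ ε₂₉ B₃ B₃' a₀ a₁) p) (m + 1) ≤ 2 * ((theta13OfThm1CCMW F 2 j γ ε₀ ε₂₉ B₃ B₃' a₀ a₁).s2.cR * epsOfRecord (theta13OfThm1CCMW F 2 j γ ε₀ ε₂₉ B₃ B₃' a₀ a₁).ν (gOfRecord₁₃ F 2 (theta13OfThm1CCMW F 2 j γ ε₀ ε₂₉ B₃ B₃' a₀ a₁) p) m)) :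
    ∃ θ : Stage13Params F 2, θ.Provisos₁₃SepCoP F 2 ∧ (θ.ZtUnity F 2 ∧ θ.SlotsNondegenerate₁₃ F 2) ∧ θ.Admissible F 2 :=
  exists_k0SepCoP_of_bgSepCoP_theta13LiveOfNumerics F (stage12NumericsOfThm1CCMW_pos_of_le_half (L := F.L) (j := j) F.hL.2.le hγ0 hγ hε hB hB' ha₀ ha₁) hε' ⟨j, rfl⟩ (dvd_refl _)
    (bgSepCoPAt_theta13OfThm1CCMW_of_thm1RegSepCoP7MG_of_thm1GaugeG_of_hcomp_allTorus hγ0 hγ hε hε' hB hB' ha₀ ha₁ hc hc₀ h15 h15G hDat hseam hcomp hcompRev)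

/-- **THE ⁷ IMAGE, ON EVERY FAMILY, FROM THE GUARDED (8)** (FILE 18's cured lift, T's history-blind door) — p575996 §4's `exists_k0SepCoPH_thm1CCMW_of_thm1GaugeR_of_hcomp_allTorus` in G-currency.
[cite: Balaban1985Variational, Thm 1 (8) p.279, Prop. 8 p.304, p.304 lines 1–2; Balaban1988Convergent, Thm 1 p.262, (2.21) p.258, (3.16)–(3.23) pp.268–270; Balaban1989LargeFieldI, (0.2)–(0.4) p.176] -/
theorem exists_k0SepCoPH_thm1CCMW_of_thm1RegSepCoP7MG_of_thm1GaugeG_of_hcomp_allTorus (F : T4Family) {Dat : TopData F 2} (hγ0 : 0 < γ) (hγ : γ ≤ 1 / 2) (hε : 0 < ε₀) (hε' : 0 < ε₂₉) (hB : 0 ≤ B₃)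
    (hB' : 0 ≤ B₃') (ha₀ : 0 < a₀) (ha₁ : 0 < a₁) (hc : c ≤ F.L ^ j) (hc₀ : c₀ ≤ j + 1)
    (h15 : VariationalThm1RegSepCoP7MGB F 2 (fun ν _M _g K k _s => c ≤ ν.M₁ ∧ k + c₀ ≤ F.m + K) (lamDatum F) Dat B₃ a₀ a₁)
    (h15G : VariationalThm1GaugeRegSepCoP7MGB F 2 (F.L ^ j) (fun ν _M _g K k _s => c ≤ ν.M₁ ∧ k + c₀ ≤ F.m + K) (lamDatum F) Dat B₃ B₃' a₀ a₁)
    (hDat : ∀ (θ : Stage13Params F 2) (p : B12.RunParams) (n : ℕ) (s : SeqOfRecord F θ.ν θ.τ9.M (gOfRecord₁₃ F 2 θ p) p.K n) (δ : ℕ → ℝ) (W : MSField (F.P p.K) (SU 2)), n ≤ p.K → PartCompat₁₃ F 2 θ p n →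
      Sect2.DataSmall7PTop (avOfRecord F 2 p.K) s.Ω (suppDomOfRecord F θ.ν p.K s.Ω) n δ W → Dat p.K s.Ω (suppDomOfRecord F θ.ν p.K s.Ω) n δ W)
    (hseam : ∀ (θ : Stage13Params F 2) (p : B12.RunParams) (n : ℕ) (s : SeqOfRecord F θ.ν θ.τ9.M (gOfRecord₁₃ F 2 θ p) p.K (n + 1)) (W : MSField (F.P p.K) (SU 2)),
      UbgOfRecord₁₃CoP F 2 θ p (n + 1) s W = UbgMSCoPOfRecordB F 2 θ.ν θ.τ9.M (gOfRecord₁₃ F 2 θ p) p.K (n + 1) s W)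
    (hcomp : ∀ (p : B12.RunParams) (n : ℕ), n ≤ p.K → Step.InInterval (theta13OfThm1CCMW F 2 j γ ε₀ ε₂₉ B₃ B₃' a₀ a₁).γ n (gOfRecord₁₃ F 2 (theta13OfThm1CCMW F 2 j γ ε₀ ε₂₉ B₃ B₃' a₀ a₁) p) → ∀ m, m < n →
      (theta13OfThm1CCMW F 2 j γ ε₀ ε₂₉ B₃ B₃' a₀ a₁).s2.cR * epsOfRecord (theta13OfThm1CCMW F 2 j γ ε₀ ε₂₉ B₃ B₃' a₀ a₁).ν (gOfRecord₁₃ F 2 (theta13OfThm1CCMW F 2 j γ ε₀ ε₂₉ B₃ B₃' a₀ a₁) p) m ≤ 2 * ((theta13OfThm1CCMW F 2 j γ ε₀ ε₂₉ B₃ B₃' a₀ a₁).s2.cR * epsOfRecord (theta13OfThm1CCMW F 2 j γ ε₀ ε₂₉ B₃ B₃' a₀ a₁).ν (gOfRecord₁₃ F 2 (theta13OfThm1CCMW F 2 j γ ε₀ ε₂₉ B₃ B₃' a₀ a₁) p) (m + 1)))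
    (hcompRev : ∀ (p : B12.RunParams) (n : ℕ), n ≤ p.K → Step.InInterval (theta13OfThm1CCMW F 2 j γ ε₀ ε₂₉ B₃ B₃' a₀ a₁).γ n (gOfRecord₁₃ F 2 (theta13OfThm1CCMW F 2 j γ ε₀ ε₂₉ B₃ B₃' a₀ a₁) p) → ∀ m, m < n →
      (theta13OfThm1CCMW F 2 j γ ε₀ ε₂₉ B₃ B₃' a₀ a₁).s2.cR * epsOfRecord (theta13OfThm1CCMW F 2 j γ ε₀ ε₂₉ B₃ B₃' a₀ a₁).ν (gOfRecord₁₃ F 2 (theta13OfThm1CCMW F 2 j γ ε₀ ε₂₉ B₃ B₃' a₀ a₁) p) (m + 1) ≤ 2 * ((theta13OfThm1CCMW F 2 j γ ε₀ ε₂₉ B₃ B₃' a₀ a₁).s2.cR * epsOfRecord (theta13OfThm1CCMW F 2 j γ ε₀ ε₂₉ B₃ B₃' a₀ a₁).ν (gOfRecord₁₃ F 2 (theta13OfThm1CCMW F 2 j γ ε₀ ε₂₉ B₃ B₃' a₀ a₁) p) m)) :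
    ∃ θ : Stage13HParams F 2, θ.Provisos₁₃SepCoPH F 2 ∧ (θ.ZhUnity F 2 ∧ θ.SlotsNondegenerate₁₃ F 2) ∧ θ.Admissible F 2 :=
  exists_k0SepCoPH_of_exists_k0SepCoPR (exists_k0SepCoPR_of_exists_k0SepCoP F
    (exists_k0SepCoP_thm1CCMW_of_thm1RegSepCoP7MG_of_thm1GaugeG_of_hcomp_allTorus F hγ0 hγ hε hε' hB hB' ha₀ ha₁ hc hc₀ h15 h15G hDat hseam hcomp hcompRev))

/-- **THE ⁷ K0 BODY KEYED ON THE GUARDED (8) AND THE GUARDED (9)-STEP FACT OVER `(lamDatum F, Dat)` AT `(L^j, Adm)` (S1b-1's token), (hcomp) ∧ (hcompRev), ON EVERY FAMILY** (minimal ⇒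
critical: S1b-2 `variationalThm1GaugeRegSepCoP7MGB_of_gauge9TopStepGB`) — p575996 §4's `exists_k0SepCoPH_thm1CCMW_of_gauge9TopStepR_of_hcomp_allTorus` in G-currency.  CONDITIONAL.
[cite: Balaban1985Variational, Thm 1 (8)–(9) p.279, (144)–(152) pp.300–301, Prop. 8 p.304, p.304 lines 1–2; Balaban1988Convergent, Thm 1 p.262, (2.21) p.258, p.257; Balaban1989LargeFieldI, (0.2)–(0.4) p.176] -/
theorem exists_k0SepCoPH_thm1CCMW_of_thm1RegSepCoP7MG_of_gauge9TopStepG_of_hcomp_allTorus (F : T4Family) {Dat : TopData F 2} (hγ0 : 0 < γ) (hγ : γ ≤ 1 / 2) (hε : 0 < ε₀) (hε' : 0 < ε₂₉)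
    (hB : 0 ≤ B₃) (hB' : 0 ≤ B₃') (ha₀ : 0 < a₀) (ha₁ : 0 < a₁) (hc : c ≤ F.L ^ j) (hc₀ : c₀ ≤ j + 1)
    (h15 : VariationalThm1RegSepCoP7MGB F 2 (fun ν _M _g K k _s => c ≤ ν.M₁ ∧ k + c₀ ≤ F.m + K) (lamDatum F) Dat B₃ a₀ a₁)
    (h9 : Gauge9RegSepTopStepGB F 2 (fun ν K Ω => suppDomOfRecord F ν K Ω) (F.L ^ j) (fun ν _M _g K k _s => c ≤ ν.M₁ ∧ k + c₀ ≤ F.m + K) (lamDatum F) Dat B₃ B₃' a₀ a₁)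
    (hDat : ∀ (θ : Stage13Params F 2) (p : B12.RunParams) (n : ℕ) (s : SeqOfRecord F θ.ν θ.τ9.M (gOfRecord₁₃ F 2 θ p) p.K n) (δ : ℕ → ℝ) (W : MSField (F.P p.K) (SU 2)), n ≤ p.K → PartCompat₁₃ F 2 θ p n →
      Sect2.DataSmall7PTop (avOfRecord F 2 p.K) s.Ω (suppDomOfRecord F θ.ν p.K s.Ω) n δ W → Dat p.K s.Ω (suppDomOfRecord F θ.ν p.K s.Ω) n δ W)
    (hseam : ∀ (θ : Stage13Params F 2) (p : B12.RunParams) (n : ℕ) (s : SeqOfRecord F θ.ν θ.τ9.M (gOfRecord₁₃ F 2 θ p) p.K (n + 1)) (W : MSField (F.P p.K) (SU 2)),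
      UbgOfRecord₁₃CoP F 2 θ p (n + 1) s W = UbgMSCoPOfRecordB F 2 θ.ν θ.τ9.M (gOfRecord₁₃ F 2 θ p) p.K (n + 1) s W)
    (hcomp : ∀ (p : B12.RunParams) (n : ℕ), n ≤ p.K → Step.InInterval (theta13OfThm1CCMW F 2 j γ ε₀ ε₂₉ B₃ B₃' a₀ a₁).γ n (gOfRecord₁₃ F 2 (theta13OfThm1CCMW F 2 j γ ε₀ ε₂₉ B₃ B₃' a₀ a₁) p) → ∀ m, m < n →
      (theta13OfThm1CCMW F 2 j γ ε₀ ε₂₉ B₃ B₃' a₀ a₁).s2.cR * epsOfRecord (theta13OfThm1CCMW F 2 j γ ε₀ ε₂₉ B₃ B₃' a₀ a₁).ν (gOfRecord₁₃ F 2 (theta13OfThm1CCMW F 2 j γ ε₀ ε₂₉ B₃ B₃' a₀ a₁) p) m ≤ 2 * ((theta13OfThm1CCMW F 2 j γ ε₀ ε₂₉ B₃ B₃' a₀ a₁).s2.cR * epsOfRecord (theta13OfThm1CCMW F 2 j γ ε₀ ε₂₉ B₃ B₃' a₀ a₁).ν (gOfRecord₁₃ F 2 (theta13OfThm1CCMW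 F 2 j γ ε₀ ε₂₉ B₃ B₃' a₀ a₁) p) (m + 1)))
    (hcompRev : ∀ (p : B12.RunParams) (n : ℕ), n ≤ p.K → Step.InInterval (theta13OfThm1CCMW F 2 j γ ε₀ ε₂₉ B₃ B₃' a₀ a₁).γ n (gOfRecord₁₃ F 2 (theta13OfThm1CCMW F 2 j γ ε₀ ε₂₉ B₃ B₃' a₀ a₁) p) → ∀ m, m < n →
      (theta13OfThm1CCMW F 2 j γ ε₀ ε₂₉ B₃ B₃' a₀ a₁).s2.cR * epsOfRecord (theta13OfThm1CCMW F 2 j γ ε₀ ε₂₉ B₃ B₃' a₀ a₁).ν (gOfRecord₁₃ F 2 (theta13OfThm1CCMW F 2 j γ ε₀ ε₂₉ B₃ B₃' a₀ a₁) p) (m + 1) ≤ 2 * ((theta13OfThm1CCMW F 2 j γ ε₀ ε₂₉ B₃ B₃' a₀ a₁).s2.cR * epsOfRecord (theta13OfThm1CCMW F 2 j γ ε₀ ε₂₉ B₃ B₃' a₀ a₁).ν (gOfRecord₁₃ F 2 (theta13OfThm1CCMW F 2 j γ ε₀ ε₂₉ B₃ B₃' a₀ a₁) p) m)) :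
    ∃ θ : Stage13HParams F 2, θ.Provisos₁₃SepCoPH F 2 ∧ (θ.ZhUnity F 2 ∧ θ.SlotsNondegenerate₁₃ F 2) ∧ θ.Admissible F 2 :=
  exists_k0SepCoPH_thm1CCMW_of_thm1RegSepCoP7MG_of_thm1GaugeG_of_hcomp_allTorus F hγ0 hγ hε hε' hB hB' ha₀ ha₁ hc hc₀ h15
    (variationalThm1GaugeRegSepCoP7MGB_of_gauge9TopStepGB h9) hDat hseam hcomp hcompRev

end ClosersGuarded

/-! ## §4  PART 1 in G-currency: the body at an arbitrary cube letter, the stub-level composition with a GENERIC G-supplier, NODE O's socket on the G text -/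

section Part1Guarded

/-- **★ THE ⁷ K0 BODY FOR `F` AT AN ARBITRARY CUBE LETTER `(L^j, c, c₀)` WITH `c ≤ L^j`, `c₀ ≤ j + 1`, FROM THE GUARDED (8), THE GUARDED (9)-TOKEN AT `(L^j, Adm)` AND ONE ABS β-BOX OF
`θ₁₅ᶜᶜᴹ(j)`** — PART 1's `exists_k0H_of_thm1CoP7M_of_gauge9R_of_absBox` (p589753 §2) in G-currency over `(lamDatum F, Dat)`: PART 1 §1 `clausesH_of_absBox` (token-free; inlined here — its
module is Stage-2 residue) gives (hcomp) ∧ (hcompRev) at `θ₁₅ᶜᶜᴹᵂ(j; γ)`, then §3.  CONDITIONAL. [cite: Balaban1985Variational, Thm 1 (8)–(9) p.279, (144)–(152) pp.300–301, Prop. 8 p.304, p.304 lines 1–2; Balaban1988Convergent, Thm 1 p.262, (2.6)–(2.8) pp.255–256, p.257, (2.21) p.258; Balaban1987RG1, Thm 1 p.259, (0.1) p.251, (1.12) p.262, §1 p.264] -/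
theorem exists_k0H_of_thm1CoP7MG_of_gauge9G_of_absBox (F : T4Family) {Dat : TopData F 2} {j c c₀ : ℕ} (hc : c ≤ F.L ^ j) (hc₀ : c₀ ≤ j + 1) {B₃ B₉ a₀ a₁ : ℝ} (hB₃ : 0 ≤ B₃) (hB₉ : 0 ≤ B₉)
    (ha₀ : 0 < a₀) (ha₁ : 0 < a₁) (h15 : VariationalThm1RegSepCoP7MGB F 2 (fun ν _M _g K k _s => c ≤ ν.M₁ ∧ k + c₀ ≤ F.m + K) (lamDatum F) Dat B₃ a₀ a₁)
    (h9 : Gauge9RegSepTopStepGB F 2 (fun ν K Ω => suppDomOfRecord F ν K Ω) (F.L ^ j) (fun ν _M _g K k _s => c ≤ ν.M₁ ∧ k + c₀ ≤ F.m + K) (lamDatum F) Dat B₃ B₉ a₀ a₁)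
    (hDat : ∀ (θ : Stage13Params F 2) (p : B12.RunParams) (n : ℕ) (s : SeqOfRecord F θ.ν θ.τ9.M (gOfRecord₁₃ F 2 θ p) p.K n) (δ : ℕ → ℝ) (W : MSField (F.P p.K) (SU 2)), n ≤ p.K → PartCompat₁₃ F 2 θ p n →
      Sect2.DataSmall7PTop (avOfRecord F 2 p.K) s.Ω (suppDomOfRecord F θ.ν p.K s.Ω) n δ W → Dat p.K s.Ω (suppDomOfRecord F θ.ν p.K s.Ω) n δ W)
    (hseam : ∀ (θ : Stage13Params F 2) (p : B12.RunParams) (n : ℕ) (s : SeqOfRecord F θ.ν θ.τ9.M (gOfRecord₁₃ F 2 θ p) p.K (n + 1)) (W : MSField (F.P p.K) (SU 2)),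
      UbgOfRecord₁₃CoP F 2 θ p (n + 1) s W = UbgMSCoPOfRecordB F 2 θ.ν θ.τ9.M (gOfRecord₁₃ F 2 θ p) p.K (n + 1) s W)
    (h3A : ∃ γ₀ ε₀ ε₂₉ β' : ℝ, 0 < γ₀ ∧ 0 < ε₀ ∧ 0 < ε₂₉ ∧
        BetaLowerH (-β') γ₀ (betaOfRecord₁₃ F 2 (theta13OfThm1CCM F 2 j ε₀ ε₂₉ B₃ B₉ a₀ a₁)) ∧
        BetaUpperH β' γ₀ (betaOfRecord₁₃ F 2 (theta13OfThm1CCM F 2 j ε₀ ε₂₉ B₃ B₉ a₀ a₁))) :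
    ∃ θ : Stage13HParams F 2, θ.Provisos₁₃SepCoPH F 2 ∧ (θ.ZhUnity F 2 ∧ θ.SlotsNondegenerate₁₃ F 2) ∧ θ.Admissible F 2 := by
  -- ONE abs β-box ⟹ the sign-free clauses at some window `γ ≤ ½` (the residue module `…K0GenericCubeOfStepTokensR`'s token-free `clausesH_of_absBox`, inlined: window shrink + Dʷ∕Eʷ)
  obtain ⟨γ₀, ε₀, ε₂₉, β', hγ00, hε, hε', hlow, hup⟩ := h3A
  have hv : (fun _ : Fin (0 + 1) => γ₀) ∈ Box γ₀ 0 := mem_box.mpr fun _ => ⟨hγ00, le_rfl⟩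
  have hβ' : 0 ≤ β' := by linarith [hlow 0 _ hv, hup 0 _ hv]
  obtain ⟨γ, hγ0, hγle, hγ, hl, hu⟩ := exists_window_letters_signFree hγ00 hβ'
  obtain ⟨hcomp, hcompRev⟩ := hcompBoth_theta13OfThm1CCMW_of_betaBoxSignFree_half (ε₀ := ε₀) (ε₂₉ := ε₂₉) hγ hB₃ hB₉ ha₀.le ha₁.le
    (fun k v hv => hlow k v (box_mono hγle k hv)) (fun k v hv => hup k v (box_mono hγle k hv)) hl hu
  exact exists_k0SepCoPH_thm1CCMW_of_thm1RegSepCoP7MG_of_gauge9TopStepG_of_hcomp_allTorus F hγ0 hγ hε hε' hB₃ hB₉ ha₀ ha₁ hc hc₀ h15 h9 hDat hseam hcomp hcompRev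

/-- **★★ K0⁷'s BODY AT EVERY FAMILY FROM V20-G's STUB 1, A GENERIC GUARDED (9)-SUPPLIER, AND V20-G's 3ᴬ′** — PART 1's `record13SepCoPHBody_of_stub1_of_gauge9Supplier_of_absBetaBoxAt`
(p589753 §3) in G-currency: `h1G` = the V20 option-G stub-1 text VERBATIM ([15] Prop. 8's top step at the record's support selector under the two-letter guard, for SOME `(c, c₀)` and
guarded `(B₃, a₀, a₁)`, the letters ∃-bound OUTERMOST); `hSG` = «for every family, letters `(c, c₀)` and guarded `(B₃, a₀, a₁)` carrying the guarded top step, SOME cube letter `(j, c′)`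
with `c ≤ c′ ≤ L^j` and `c₀ ≤ j + 1`, some `B₉ > 0` and a ceiling `0 < a₁′ ≤ a₁` carry the guarded (9)-token at `(L^j, Adm(c′, c₀))`» (PART 2-G instantiates it from stub 2′ at
`j := ρ₀ + 3 + c + c₀`, `c′ := max c ((11·4 + 4ρ₀L)·L)` through S1b-1 `gauge9GBP_of_prop8TopStepGB_of_prop6P_of_one_le`); `h3A'G` = 3ᴬ′ with BOTH antecedents guarded at the
SAME `(c, c₀)` and the dischargeability letters `c ≤ L^j`, `c₀ ≤ j + 1`; all texts over PRINT's [II] (2.3) datum `lamDatum F` and a family of data predicates `DatF F` with the (7) transfer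
`hDat` (Stage-2 re-key).  Proof: stub 1 ⇒ the guarded (8) `CoP` sentence (53′ `variationalThm1RegSepCoP7MGB_of_prop8TopStepGB_lamDatum`, ceiling shrunk by `.of_le`, guard refined from
`(c, c₀)` to `(c′, c₀)` by `.of_imp`), `hSG` ⇒ (9), `h3A'G` ⇒ the box ⇒ `exists_k0H_of_thm1CoP7MG_of_gauge9G_of_absBox`.  CONDITIONAL; K0⁷ NOT closed here; nothing of Bałaban asserted. [cite: Balaban1985Variational, Thm 1 (8)–(9) p.279, (144)–(152) pp.300–301, Prop. 8 p.304, p.304 lines 1–2; Balaban1985RegularSpaces, (1.3)–(1.6) p.77, Prop. 6 p.99, p.98; Balaban1988Convergent, Thm 1 p.262, (2.6)–(2.8) pp.255–256, p.257; Balaban1987RG1, Thm 1 p.259, (0.1) p.251, §1 p.264] -/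
theorem record13SepCoPHBody_of_stub1G_of_gauge9SupplierG_of_absBetaBoxAtG {DatF : (F : T4Family) → TopData F 2}
    (hDat : ∀ (F : T4Family) (θ : Stage13Params F 2) (p : B12.RunParams) (n : ℕ) (s : SeqOfRecord F θ.ν θ.τ9.M (gOfRecord₁₃ F 2 θ p) p.K n) (δ : ℕ → ℝ) (W : MSField (F.P p.K) (SU 2)), n ≤ p.K → PartCompat₁₃ F 2 θ p n →
      Sect2.DataSmall7PTop (avOfRecord F 2 p.K) s.Ω (suppDomOfRecord F θ.ν p.K s.Ω) n δ W → DatF F p.K s.Ω (suppDomOfRecord F θ.ν p.K s.Ω) n δ W)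
    (hseam : ∀ (F : T4Family) (θ : Stage13Params F 2) (p : B12.RunParams) (n : ℕ) (s : SeqOfRecord F θ.ν θ.τ9.M (gOfRecord₁₃ F 2 θ p) p.K (n + 1)) (W : MSField (F.P p.K) (SU 2)),
      UbgOfRecord₁₃CoP F 2 θ p (n + 1) s W = UbgMSCoPOfRecordB F 2 θ.ν θ.τ9.M (gOfRecord₁₃ F 2 θ p) p.K (n + 1) s W)
    (h1G : ∀ F : T4Family, ∃ (c c₀ : ℕ) (B₃ a₀ a₁ : ℝ), 2 * (F.L : ℝ) ^ 2 ≤ B₃ ∧ 0 < a₀ ∧ 0 < a₁ ∧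
      Prop8RegSepTopStepGB F 2 (fun ν K Ω => suppDomOfRecord F ν K Ω) (fun ν _M _g K k _s => c ≤ ν.M₁ ∧ k + c₀ ≤ F.m + K) (lamDatum F) (DatF F) B₃ a₀ a₁)
    (hSG : ∀ (F : T4Family) (c c₀ : ℕ) (B₃ a₀ a₁ : ℝ), 2 * (F.L : ℝ) ^ 2 ≤ B₃ → 0 < a₀ → 0 < a₁ →
      Prop8RegSepTopStepGB F 2 (fun ν K Ω => suppDomOfRecord F ν K Ω) (fun ν _M _g K k _s => c ≤ ν.M₁ ∧ k + c₀ ≤ F.m + K) (lamDatum F) (DatF F) B₃ a₀ a₁ →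
      ∃ (j c' : ℕ) (B₉ a₁' : ℝ), c ≤ c' ∧ c' ≤ F.L ^ j ∧ c₀ ≤ j + 1 ∧ 0 < B₉ ∧ 0 < a₁' ∧ a₁' ≤ a₁ ∧
        Gauge9RegSepTopStepGB F 2 (fun ν K Ω => suppDomOfRecord F ν K Ω) (F.L ^ j) (fun ν _M _g K k _s => c' ≤ ν.M₁ ∧ k + c₀ ≤ F.m + K) (lamDatum F) (DatF F) B₃ B₉ a₀ a₁')
    (h3A'G : ∀ (F : T4Family) (j c c₀ : ℕ) (B₃ B₃' a₀ a₁ : ℝ), c ≤ F.L ^ j → c₀ ≤ j + 1 → 2 * (F.L : ℝ) ^ 2 ≤ B₃ → 0 < B₃' → 0 < a₀ → 0 < a₁ →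
      VariationalThm1RegSepCoP7MGB F 2 (fun ν _M _g K k _s => c ≤ ν.M₁ ∧ k + c₀ ≤ F.m + K) (lamDatum F) (DatF F) B₃ a₀ a₁ →
      Gauge9RegSepTopStepGB F 2 (fun ν K Ω => suppDomOfRecord F ν K Ω) (F.L ^ j) (fun ν _M _g K k _s => c ≤ ν.M₁ ∧ k + c₀ ≤ F.m + K) (lamDatum F) (DatF F) B₃ B₃' a₀ a₁ →
      ∃ γ₀ ε₀ ε₂₉ β' : ℝ, 0 < γ₀ ∧ 0 < ε₀ ∧ 0 < ε₂₉ ∧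
        BetaLowerH (-β') γ₀ (betaOfRecord₁₃ F 2 (theta13OfThm1CCM F 2 j ε₀ ε₂₉ B₃ B₃' a₀ a₁)) ∧
        BetaUpperH β' γ₀ (betaOfRecord₁₃ F 2 (theta13OfThm1CCM F 2 j ε₀ ε₂₉ B₃ B₃' a₀ a₁))) :
    ∀ F : T4Family, ∃ θ : Stage13HParams F 2, θ.Provisos₁₃SepCoPH F 2 ∧ (θ.ZhUnity F 2 ∧ θ.SlotsNondegenerate₁₃ F 2) ∧ θ.Admissible F 2 := by
  intro F
  obtain ⟨c, c₀, B₃, a₀, a₁, hB₃, ha₀, ha₁, h8⟩ := h1G F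
  have hL : (0 : ℝ) < (F.L : ℝ) := by exact_mod_cast lt_trans Nat.zero_lt_one F.hL.2
  have hBpos : (0 : ℝ) < B₃ := lt_of_lt_of_le (mul_pos two_pos (pow_pos hL 2)) hB₃
  obtain ⟨j, c', B₉, a₁', hcc', hc', hc₀, hB₉, ha₁', ha₁'le, h9⟩ := hSG F c c₀ B₃ a₀ a₁ hB₃ ha₀ ha₁ h8
  have h15 : VariationalThm1RegSepCoP7MGB F 2 (fun ν _M _g K k _s => c' ≤ ν.M₁ ∧ k + c₀ ≤ F.m + K) (lamDatum F) (DatF F) B₃ a₀ a₁' :=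
    (variationalThm1RegSepCoP7MGB_of_prop8TopStepGB_lamDatum hBpos (h8.of_le le_rfl ha₁'le)).of_imp fun _ _ _ _ _ _ h => ⟨hcc'.trans h.1, h.2⟩
  exact exists_k0H_of_thm1CoP7MG_of_gauge9G_of_absBox F hc' hc₀ hBpos.le hB₉.le ha₀ ha₁' h15 h9 (hDat F) (hseam F)
    (h3A'G F j c' c₀ B₃ B₉ a₀ a₁' hc' hc₀ hB₃ hB₉ ha₀ ha₁' h15 h9)

/-- **NODE O's JETS-FREE PAIR AT A1's WITNESS `θ₁₅ᶜᶜᴹ(j)` SUPPLIES V20-G's 3ᴬ′ AT THE CUBE LETTER `(j, c, c₀)`** — PART 1 §4's `absBetaBoxAt_of_jetsFreePairAt` with both antecedents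
guarded and read over `(lamDatum F, Dat)`; N26's `exists_betaBox_betaOfRecord₁₃_of_jetsFreePair` is θ-generic, so the proof is the same three lines.  CONDITIONAL on the pair; NOT proved; no
sign; nothing asserted.
[cite: Balaban1987RG1, Thm 2 p.259, §1 p.264, (2.12)–(2.14) p.268, (5.10) p.293; Balaban1988RG2Cluster, Lemma 3 (2.38) p.20; Balaban1985Variational, Thm 1 p.279, Prop. 8 p.304, p.304 lines 1–2] -/
theorem absBetaBoxAtG_of_jetsFreePairAtG (F : T4Family) {Dat : TopData F 2} (j c c₀ : ℕ)
    (h : ∀ B₃ B₃' a₀ a₁ : ℝ, 2 * (F.L : ℝ) ^ 2 ≤ B₃ → 0 < B₃' → 0 < a₀ → 0 < a₁ →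
      VariationalThm1RegSepCoP7MGB F 2 (fun ν _M _g K k _s => c ≤ ν.M₁ ∧ k + c₀ ≤ F.m + K) (lamDatum F) Dat B₃ a₀ a₁ →
      Gauge9RegSepTopStepGB F 2 (fun ν K Ω => suppDomOfRecord F ν K Ω) (F.L ^ j) (fun ν _M _g K k _s => c ≤ ν.M₁ ∧ k + c₀ ≤ F.m + K) (lamDatum F) Dat B₃ B₃' a₀ a₁ →
      ∃ ε₀ ε₂₉ : ℝ, 0 < ε₀ ∧ 0 < ε₂₉ ∧
        (letI := (theta13OfThm1CCM F 2 j ε₀ ε₂₉ B₃ B₃' a₀ a₁).instVβ₁; letI := (theta13OfThm1CCM F 2 j ε₀ ε₂₉ B₃ B₃' a₀ a₁).instVβ₂;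
         letI := (theta13OfThm1CCM F 2 j ε₀ ε₂₉ B₃ B₃' a₀ a₁).instιβ
         ∃ d A : ℝ, 0 ≤ d ∧
           OneLoopDrift d A (beta0OfMerged (betaMerged F (mergedTermFamilyMatT F 2 (TcanOfRecord F 2)
             (chiFixed29 F 2 (theta13OfThm1CCM F 2 j ε₀ ε₂₉ B₃ B₃' a₀ a₁).ν (theta13OfThm1CCM F 2 j ε₀ ε₂₉ B₃ B₃' a₀ a₁).ε₂₉) (theta13OfThm1CCM F 2 j ε₀ ε₂₉ B₃ B₃' a₀ a₁).εbg)
             (theta13OfThm1CCM F 2 j ε₀ ε₂₉ B₃ B₃' a₀ a₁).ρ8 (theta13OfThm1CCM F 2 j ε₀ ε₂₉ B₃ B₃' a₀ a₁).bV) (theta13OfThm1CCM F 2 j ε₀ ε₂₉ B₃ B₃' a₀ a₁).v₀) ∧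
           ∃ γ₀ : ℝ, 0 < γ₀ ∧ γ₀ ≤ (theta13OfThm1CCM F 2 j ε₀ ε₂₉ B₃ B₃' a₀ a₁).γ ∧
             AtSlopeCont
               (oneLoopSplit_betaOfMerged
                 (betaMerged F (mergedTermFamilyMatT F 2 (TcanOfRecord F 2)
                   (chiFixed29 F 2 (theta13OfThm1CCM F 2 j ε₀ ε₂₉ B₃ B₃' a₀ a₁).ν (theta13OfThm1CCM F 2 j ε₀ ε₂₉ B₃ B₃' a₀ a₁).ε₂₉) (theta13OfThm1CCM F 2 j ε₀ ε₂₉ B₃ B₃' a₀ a₁).εbg)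
                   (theta13OfThm1CCM F 2 j ε₀ ε₂₉ B₃ B₃' a₀ a₁).ρ8 (theta13OfThm1CCM F 2 j ε₀ ε₂₉ B₃ B₃' a₀ a₁).bV)
                 (beta0OfMerged (betaMerged F (mergedTermFamilyMatT F 2 (TcanOfRecord F 2)
                   (chiFixed29 F 2 (theta13OfThm1CCM F 2 j ε₀ ε₂₉ B₃ B₃' a₀ a₁).ν (theta13OfThm1CCM F 2 j ε₀ ε₂₉ B₃ B₃' a₀ a₁).ε₂₉) (theta13OfThm1CCM F 2 j ε₀ ε₂₉ B₃ B₃' a₀ a₁).εbg)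
                   (theta13OfThm1CCM F 2 j ε₀ ε₂₉ B₃ B₃' a₀ a₁).ρ8 (theta13OfThm1CCM F 2 j ε₀ ε₂₉ B₃ B₃' a₀ a₁).bV) (theta13OfThm1CCM F 2 j ε₀ ε₂₉ B₃ B₃' a₀ a₁).v₀)
                 (theta13OfThm1CCM F 2 j ε₀ ε₂₉ B₃ B₃' a₀ a₁).γ)
               γ₀ d)) :
    ∀ B₃ B₃' a₀ a₁ : ℝ, 2 * (F.L : ℝ) ^ 2 ≤ B₃ → 0 < B₃' → 0 < a₀ → 0 < a₁ →
      VariationalThm1RegSepCoP7MGB F 2 (fun ν _M _g K k _s => c ≤ ν.M₁ ∧ k + c₀ ≤ F.m + K) (lamDatum F) Dat B₃ a₀ a₁ →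
      Gauge9RegSepTopStepGB F 2 (fun ν K Ω => suppDomOfRecord F ν K Ω) (F.L ^ j) (fun ν _M _g K k _s => c ≤ ν.M₁ ∧ k + c₀ ≤ F.m + K) (lamDatum F) Dat B₃ B₃' a₀ a₁ →
      ∃ γ₀ ε₀ ε₂₉ β' : ℝ, 0 < γ₀ ∧ 0 < ε₀ ∧ 0 < ε₂₉ ∧
        BetaLowerH (-β') γ₀ (betaOfRecord₁₃ F 2 (theta13OfThm1CCM F 2 j ε₀ ε₂₉ B₃ B₃' a₀ a₁)) ∧
        BetaUpperH β' γ₀ (betaOfRecord₁₃ F 2 (theta13OfThm1CCM F 2 j ε₀ ε₂₉ B₃ B₃' a₀ a₁)) := by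
  intro B₃ B₃' a₀ a₁ hB₃ hB₃' ha₀ ha₁ h15 h9
  obtain ⟨ε₀, ε₂₉, hε, hε', hJ⟩ := h B₃ B₃' a₀ a₁ hB₃ hB₃' ha₀ ha₁ h15 h9
  obtain ⟨γ₀, hγ0, -, β', -, hup, hlow, -⟩ := exists_betaBox_betaOfRecord₁₃_of_jetsFreePair F 2 (theta13OfThm1CCM F 2 j ε₀ ε₂₉ B₃ B₃' a₀ a₁) hJ
  exact ⟨γ₀, ε₀, ε₂₉, β', hγ0, hε, hε', hlow, hup⟩

end Part1Guarded

/-! ## §5  The directions (displayed, kernel): V20-R stub 1 ⟹ V20-G stub 1; V20-G 3ᴬ′ ⟹ V20-R 3ᴬ′ — over `(lamDatum F, Dat)`, R = the floor guard `floorGuard F c` -/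

section Direction

/-- **V20-R's STUB 1 ⟹ V20-G's STUB 1 AT `F`** over `(lamDatum F, Dat)` (R = the floor guard `floorGuard F c`, S1a-C∕S1b-1's `…R_iff_GB_floorGuard` currency; any `c₀`, e.g. `c₀ = 0`: the
extra level letter only WEAKENS the top step, F0c `Prop8RegSepTopStepGB.of_imp`) — so a by-name proof of the R text still lands on the G text; never conversely (the G text does not ask the
wrapped prefixes `F.m + K < k + c₀`). [cite: Balaban1985Variational, Prop. 8 p.304, p.304 lines 1–2 (bookkeeping); Balaban1985RegularSpaces, (1.3)–(1.6) p.77; Balaban1987RG1, (0.1) p.251] -/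
theorem prop8StepCoPG_of_prop8StepCoPR (F : T4Family) {Dat : TopData F 2}
    (h1R : ∃ (c : ℕ) (B₃ a₀ a₁ : ℝ), 2 * (F.L : ℝ) ^ 2 ≤ B₃ ∧ 0 < a₀ ∧ 0 < a₁ ∧
      Prop8RegSepTopStepGB F 2 (fun ν K Ω => suppDomOfRecord F ν K Ω) (floorGuard F c) (lamDatum F) Dat B₃ a₀ a₁) :
    ∃ (c c₀ : ℕ) (B₃ a₀ a₁ : ℝ), 2 * (F.L : ℝ) ^ 2 ≤ B₃ ∧ 0 < a₀ ∧ 0 < a₁ ∧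
      Prop8RegSepTopStepGB F 2 (fun ν K Ω => suppDomOfRecord F ν K Ω) (fun ν _M _g K k _s => c ≤ ν.M₁ ∧ k + c₀ ≤ F.m + K) (lamDatum F) Dat B₃ a₀ a₁ := by
  obtain ⟨c, B₃, a₀, a₁, hB₃, ha₀, ha₁, h8⟩ := h1R
  exact ⟨c, 0, B₃, a₀, a₁, hB₃, ha₀, ha₁, h8.of_imp fun _ _ _ _ _ _ h => h.1⟩

/-- **V20-G's 3ᴬ′ ⟹ V20-R's 3ᴬ′ AT `F`** over `(lamDatum F, Dat)` (at `c₀ := 0`: the floor-guarded antecedents give the G ones under the guard `c ≤ ν.M₁ ∧ k + 0 ≤ F.m + K`, which implies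
the floor — S1a-C `VariationalThm1RegSepCoP7MGB.of_imp`, S1b-1 `Gauge9RegSepTopStepGB.of_imp`) — the G text is the STRONGEST stub 3 (honest display; NODE O reads the sentences, if at all,
at the witness's own guarded prefixes). [cite: Balaban1987RG1, §1 p.264 (bookkeeping); Balaban1985Variational, Thm 1 (8)–(9) p.279, p.304 lines 1–2] -/
theorem absBetaBoxAtGenR_of_absBetaBoxAtGenG (F : T4Family) {Dat : TopData F 2}
    (h3A'G : ∀ (j c c₀ : ℕ) (B₃ B₃' a₀ a₁ : ℝ), c ≤ F.L ^ j → c₀ ≤ j + 1 → 2 * (F.L : ℝ) ^ 2 ≤ B₃ → 0 < B₃' → 0 < a₀ → 0 < a₁ →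
      VariationalThm1RegSepCoP7MGB F 2 (fun ν _M _g K k _s => c ≤ ν.M₁ ∧ k + c₀ ≤ F.m + K) (lamDatum F) Dat B₃ a₀ a₁ →
      Gauge9RegSepTopStepGB F 2 (fun ν K Ω => suppDomOfRecord F ν K Ω) (F.L ^ j) (fun ν _M _g K k _s => c ≤ ν.M₁ ∧ k + c₀ ≤ F.m + K) (lamDatum F) Dat B₃ B₃' a₀ a₁ →
      ∃ γ₀ ε₀ ε₂₉ β' : ℝ, 0 < γ₀ ∧ 0 < ε₀ ∧ 0 < ε₂₉ ∧
        BetaLowerH (-β') γ₀ (betaOfRecord₁₃ F 2 (theta13OfThm1CCM F 2 j ε₀ ε₂₉ B₃ B₃' a₀ a₁)) ∧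
        BetaUpperH β' γ₀ (betaOfRecord₁₃ F 2 (theta13OfThm1CCM F 2 j ε₀ ε₂₉ B₃ B₃' a₀ a₁))) :
    ∀ (j c : ℕ) (B₃ B₃' a₀ a₁ : ℝ), c ≤ F.L ^ j → 2 * (F.L : ℝ) ^ 2 ≤ B₃ → 0 < B₃' → 0 < a₀ → 0 < a₁ →
      VariationalThm1RegSepCoP7MGB F 2 (floorGuard F c) (lamDatum F) Dat B₃ a₀ a₁ →
      Gauge9RegSepTopStepGB F 2 (fun ν K Ω => suppDomOfRecord F ν K Ω) (F.L ^ j) (floorGuard F c) (lamDatum F) Dat B₃ B₃' a₀ a₁ →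
      ∃ γ₀ ε₀ ε₂₉ β' : ℝ, 0 < γ₀ ∧ 0 < ε₀ ∧ 0 < ε₂₉ ∧
        BetaLowerH (-β') γ₀ (betaOfRecord₁₃ F 2 (theta13OfThm1CCM F 2 j ε₀ ε₂₉ B₃ B₃' a₀ a₁)) ∧
        BetaUpperH β' γ₀ (betaOfRecord₁₃ F 2 (theta13OfThm1CCM F 2 j ε₀ ε₂₉ B₃ B₃' a₀ a₁)) :=
  fun j c B₃ B₃' a₀ a₁ hc hB₃ hB₃' ha₀ ha₁ h15 h9 =>
    h3A'G j c 0 B₃ B₃' a₀ a₁ hc (Nat.zero_le _) hB₃ hB₃' ha₀ ha₁ (h15.of_imp fun _ _ _ _ _ _ h => h.1)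
      (h9.of_imp fun _ _ _ _ _ _ h => h.1)

end Direction

end Summit.QuantumFields.YangMills.Theorems.K0AllTorusOfStepTokensGuardedB

end
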